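import Mathlib

/-!
# The phase mode: a continuous symmetry puts its generator in the kernel of the
# linearisation, and the standing-pattern class excludes it (solo-blind, s48)

Kernel of solo-blind paper §24.31 (1) (correction to the typing of L3 in §24.24 (0)).

The steady forced Navier–Stokes map `N` with a `z`-independent horizontal force `f` is equivariant
under the `z`-translations `T c` and the reflection `R`.  Abstractly:

* `fderiv_generator_eq_zero` — if a curve `γ` through `u` with velocity `v` (think
  `γ c = T c u`, `v = ∂_z u`) is mapped by `N` to the constant `f`, then `fderiv ℝ N u v = 0`;
  hence (`not_injective_of_phase`, `no_inverse_bound_of_phase`) the linearisation at a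
  `z`-dependent steady state is not injective and admits no bound `‖w‖ ≤ C ‖L w‖` — the statement
  "`‖L_n⁻¹‖ ≤ C n^p` on all divergence-free fields" is false as typed.
* `map_fixed_of_commute` — a linear map commuting with `R` preserves the symmetric class
  `{v | R v = v}`; `generator_odd_of_anticommute` — an operator `D` anticommuting with `R`
  (`∂_z` versus `z ↦ -z`) sends `R`-symmetric states to `R`-odd vectors; `eq_zero_of_fixed_of_odd`
  — over `ℝ` a vector that is both `R`-fixed and `R`-odd vanishes.  Together
  (`phase_mode_not_in_class`): the phase mode `D u` of an `R`-symmetric state lies in the symmetric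
  class only if it is zero, so posing L3 on that class removes it.

Elementary calculus and linear algebra over `ℝ`; the fluid objects are not formalised.
-/

namespace Summit.AnomalousDissipation.AnomalousDissipation.Theorems

section Generator

variable {E F : Type*} [NormedAddCommGroup E] [NormedSpace ℝ E]
  [NormedAddCommGroup F] [NormedSpace ℝ F]

/-- A one-parameter family `γ` through `u = γ 0` with velocity `v` on which `N` is constant:
the generator `v` is in the kernel of the linearisation of `N` at `u`. -/
theorem fderiv_generator_eq_zero {N : E → F} {γ : ℝ → E} {u v : E} {f : F}
    (hγ0 : γ 0 = u) (hγ : HasDerivAt γ v 0) (hN : DifferentiableAt ℝ N u)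
    (hconst : ∀ c, N (γ c) = f) : fderiv ℝ N u v = 0 := by
  have h1 : HasDerivAt (N ∘ γ) (fderiv ℝ N u v) 0 := by
    have hNu : HasFDerivAt N (fderiv ℝ N u) (γ 0) := by rw [hγ0]; exact hN.hasFDerivAt
    exact hNu.comp_hasDerivAt 0 hγ
  have h2 : HasDerivAt (N ∘ γ) 0 0 := by
    have : (N ∘ γ) = fun _ => f := funext fun c => hconst c
    rw [this]; exact hasDerivAt_const 0 f
  exact h1.unique h2

/-- Hence the linearisation is not injective as soon as the generator is non-zero. -/
theorem not_injective_of_phase {N : E → F} {γ : ℝ → E} {u v : E} {f : F}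
    (hγ0 : γ 0 = u) (hγ : HasDerivAt γ v 0) (hN : DifferentiableAt ℝ N u)
    (hconst : ∀ c, N (γ c) = f) (hv : v ≠ 0) :
    ¬ Function.Injective (fderiv ℝ N u) := by
  intro hinj
  have h0 : fderiv ℝ N u v = fderiv ℝ N u 0 := by
    rw [fderiv_generator_eq_zero hγ0 hγ hN hconst, map_zero]
  exact hv (hinj h0)

/-- ... and admits no inverse bound `‖w‖ ≤ C ‖L w‖` whatsoever. -/
theorem no_inverse_bound_of_phase {N : E → F} {γ : ℝ → E} {u v : E} {f : F}
    (hγ0 : γ 0 = u) (hγ : HasDerivAt γ v 0) (hN : DifferentiableAt ℝ N u)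
    (hconst : ∀ c, N (γ c) = f) (hv : v ≠ 0) :
    ¬ ∃ C : ℝ, ∀ w : E, ‖w‖ ≤ C * ‖fderiv ℝ N u w‖ := by
  rintro ⟨C, hC⟩
  have h := hC v
  rw [fderiv_generator_eq_zero hγ0 hγ hN hconst, norm_zero, mul_zero] at h
  exact hv (norm_le_zero_iff.mp h)

/-- Approximate version (the approximate steady state): if `N ∘ γ` has derivative `r` at `0`
(`r = ∂_z Res`), then the linearisation sends the generator to `r`; so any inverse bound `C`
satisfies `‖v‖ ≤ C ‖r‖`, i.e. `C ≥ ‖v‖/‖r‖` blows up as the residual derivative `r → 0`. -/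
theorem inverse_bound_ge_of_approx_phase {N : E → F} {γ : ℝ → E} {u v : E} {r : F}
    (hγ0 : γ 0 = u) (hγ : HasDerivAt γ v 0) (hN : DifferentiableAt ℝ N u)
    (hres : HasDerivAt (N ∘ γ) r 0) {C : ℝ} (hC : ∀ w : E, ‖w‖ ≤ C * ‖fderiv ℝ N u w‖) :
    ‖v‖ ≤ C * ‖r‖ := by
  have h1 : HasDerivAt (N ∘ γ) (fderiv ℝ N u v) 0 := by
    have hNu : HasFDerivAt N (fderiv ℝ N u) (γ 0) := by rw [hγ0]; exact hN.hasFDerivAt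
    exact hNu.comp_hasDerivAt 0 hγ
  have h2 : fderiv ℝ N u v = r := h1.unique hres
  simpa [h2] using hC v

end Generator

section Reflection

variable {E : Type*} [AddCommGroup E] [Module ℝ E]

/-- A linear map commuting with `R` preserves the `R`-symmetric class. -/
theorem map_fixed_of_commute (R L : E →ₗ[ℝ] E) (h : R ∘ₗ L = L ∘ₗ R) {v : E}
    (hv : R v = v) : R (L v) = L v := by
  have := LinearMap.congr_fun h v
  simp only [LinearMap.coe_comp, Function.comp_apply] at this
  rw [this, hv]

/-- A linear map commuting with `R` also preserves the `R`-odd class. -/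
theorem map_odd_of_commute (R L : E →ₗ[ℝ] E) (h : R ∘ₗ L = L ∘ₗ R) {v : E}
    (hv : R v = -v) : R (L v) = -L v := by
  have := LinearMap.congr_fun h v
  simp only [LinearMap.coe_comp, Function.comp_apply] at this
  rw [this, hv, map_neg]

/-- An operator anticommuting with `R` (`∂_z` against `z ↦ -z`) maps `R`-symmetric states to
`R`-odd vectors: the phase mode of a standing pattern is odd. -/
theorem generator_odd_of_anticommute (R D : E →ₗ[ℝ] E) (h : R ∘ₗ D = -(D ∘ₗ R)) {u : E}
    (hu : R u = u) : R (D u) = -D u := by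
  have := LinearMap.congr_fun h u
  simp only [LinearMap.coe_comp, Function.comp_apply, LinearMap.neg_apply] at this
  rw [this, hu]

/-- Over `ℝ`, a vector that is both `R`-fixed and `R`-odd is zero. -/
theorem eq_zero_of_fixed_of_odd (R : E →ₗ[ℝ] E) {v : E} (h1 : R v = v) (h2 : R v = -v) :
    v = 0 := by
  have h : v = -v := h1.symm.trans h2
  have h2v : (2 : ℝ) • v = 0 := by
    rw [two_smul]
    nth_rewrite 2 [h]
    exact add_neg_cancel v
  rcases smul_eq_zero.mp h2v with h | h
  · norm_num at h
  · exact h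

/-- The phase mode `D u` of an `R`-symmetric state `u` belongs to the symmetric class only if it
vanishes: posing the linearised problem on `{v | R v = v}` removes it. -/
theorem phase_mode_not_in_class (R D : E →ₗ[ℝ] E) (h : R ∘ₗ D = -(D ∘ₗ R)) {u : E}
    (hu : R u = u) (hfix : R (D u) = D u) : D u = 0 :=
  eq_zero_of_fixed_of_odd R hfix (generator_odd_of_anticommute R D h hu)

/-- Contrapositive packaging: a non-zero phase mode is outside the symmetric class, while the
class itself is invariant under every `R`-commuting linearisation `L`. -/
theorem symmetric_class_excludes_phase (R D L : E →ₗ[ℝ] E) (hD : R ∘ₗ D = -(D ∘ₗ R))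
    (hL : R ∘ₗ L = L ∘ₗ R) {u : E} (hu : R u = u) (hne : D u ≠ 0) :
    R (D u) ≠ D u ∧ ∀ v, R v = v → R (L v) = L v :=
  ⟨fun hfix => hne (phase_mode_not_in_class R D hD hu hfix),
   fun _ hv => map_fixed_of_commute R L hL hv⟩

end Reflection

end Summit.AnomalousDissipation.AnomalousDissipation.Theorems
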